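import Literature.MathematicalPhysics.QuantumFieldTheory.Balaban1983to89.B9PinGeometryKLevelV1
import Literature.MathematicalPhysics.QuantumFieldTheory.Balaban1983to89.B9LeafKnitOn
import Literature.MathematicalPhysics.QuantumFieldTheory.Balaban1983to89.B9GeoNormsKLevelModelSignsV1

/-!
# `Balaban1983to89.B9PinCarriersKLevelV1` — Stage-3′(Y) GEOMETRY∕INDEX layer, MODULE 5 (capstone): the [B9] carrier bundle `carriersY ops : DagBinding.PrintedCarriers9X`
# AS A FUNCTION OF THE OPERATOR LAYER — index = `MemberY`, geometry = `geo9Y`, backgrounds = `bg9Y`, every non-operator field from MODULES 2–4, and the 25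
# operator-valued fields taken from ONE explicit parameter record `OperatorLayerY` — and the N06 knit AT THIS BUNDLE with every geometric hypothesis DISCHARGED:
# what remains displayed is exactly the operator layer's obligations (the `U = 1` comparisons, the residual entries, the sixteen whole-statement leaves)

B9 = T. Bałaban, *Propagators for lattice gauge theories in a background field*, Commun. Math. Phys. **99** (1985) 389–434 [Balaban1985BackgroundPropagators].
pub-ymgap Track A, node N06 = `Dag.B9_main`; seat `pub-ymgap-dag-n06-a` g3 = «def-Y» (director-ym LINE №32 rails (i)–(vi): Literature-side, NO stage predicate ∕
`Admissible` ∕ `Record`; the PINNING datum is an explicit PARAMETER — here the operator record `ops`).  DEFINITIONS + knit theorems; nothing of [B9] asserted;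
count-neutral; N06 NOT discharged.

WHAT IS DEFINED ∕ PROVED.
* §1 `structure OperatorLayerY 𝔸 G x` — the operator-valued fields of `PrintedCarriers9X` at ONE member `x : MemberY …` over the member's geometry `geo9Y x` and
  backgrounds `bg9Y 𝔸 G x` (G′(U), G(U) and its Sect. B companion, `(Q′G′²Q′*)⁻¹`, the analyticity predicate, the three random-walk expansions (3.90)∕(3.98)∕(3.107),
  the positivity predicates, the Sect. D operators `G_D, G₁, H, H₁, 𝔊` with their expansion∕positivity predicates, the difference family of Thm 3.14, the Sect. E kernel
  `C^{(k)}(Λ)` with (3.185)∕expansion predicates, (3.49)'s `P`, (3.132)'s kernels) — NOTHING DEFINED, a parameter record (the unassigned XL layer's interface).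
* §2 **`carriersY 𝔸 G ops : PrintedCarriers9X`** — `I9 := MemberY …`, `d9 := d + 1`, `c35 := c35Y (= 10)`, `geo9 := geo9Y`, `bg9 := bg9Y 𝔸 G`, `InCube := InCubeY`,
  `dOmega := dOmegaY`, `OmK := OmKY`, `inΛ := inΛY`, `unitDist := unitDistY`, all operator fields from `ops`; field lemmas by `rfl`.
* §3 **THE KNIT AT `carriersY`**: `b9LeafX_carriersY` = `B9LeafKnitOn.b9LeafX_of_b6BlockParam_on` at `Y := carriersY 𝔸 G ops`, `D :=` NODE 00's tower block of record
  `Node00.towerBlockOfRecord d ℓ hd hL b₀ b₁ δ₀ tree loc`, `ι x := ⟨x.toKIdx, x.hcfk⟩ : KRIdx`, with the GEOMETRIC hypotheses DISCHARGED — `hd := rfl`, `hc := c35Y_pos`,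
  `hone := reg335Y_one` (MODULE 3), `S := modelSignsOn_geo9K` (dag-n03-b p420568), `Dict := dictAtOneY` (MODULE 4) — so that the displayed hypotheses are EXACTLY:
  the eight `U = 1` operator comparisons per member (`hops1`), the null readings of `GA` off the bond summand (`hE4`, `hH2`), the residual entries `hGp`∕`hGA`, the
  Sect. B step, the gauge reduction, the sixteen leaves, and the [B6] block `B6BlockParam (towerBlockOfRecord …)` (= N03 at the record).  `b9_main_at_run_carriersY`:
  the node BY NAME at a run binding `Y := carriersY 𝔸 G ops`.
* §4 guards at the bundle: `carriersY_nonempty_I9`, `carriersY_unbounded_M`, `carriersY_exists_nonempty_Λ` (MODULE 3's), `carriersY_cor36_vacuous` (MODULE 4's located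
  fact: `InCube` is empty on the torus of record).  VACUITY-CLASS NOTE (dag-ref-A READ g5-25 of MODULE 3, restated): the only member with `Λ ≠ ∅` the tree has
  is at `L = 5` with `Ω_k = T_η` (`Λ_kᶜ = ∅`, the separation clause void) — NO member with `Λ ≠ ∅` AND a genuine multi-level structure exists yet (the V1 chart
  places top cubes only for `L ≤ 5`, n03-a (c7)); «inhabited» must not be read as «multi-level inhabited»; the witness is owed by whoever extends the chart.
HONEST SCOPE: the operator layer is a PARAMETER; no estimate; one finite lattice programme; NOT continuum ∕ OS ∕ mass gap ∕ Clay.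
-/

noncomputable section

namespace Literature.MathematicalPhysics.QuantumFieldTheory.Balaban1983to89.B9PinCarriersKLevelV1

open DagBinding
open B6KLevelCensusIndexV1 (KIdx)
open B9PinMembersKLevelV1 (MemberY geo9Y bg9Y)
open B9PinGeometryKLevelV1 (dOmegaY OmKY inΛY unitDistY InCubeY c35Y c35Y_pos dictAtOneY not_inCubeY)
open B9FromB6ModelSignsOn (ModelSignsOn)

variable (d ℓ : ℕ) (hd : 1 ≤ d + 1) (hL : Odd (ℓ + 1) ∧ 1 < ℓ + 1) (b₀ b₁ : ℝ) (Mstar : ℕ)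
variable (𝔸 : Type) [NormedRing 𝔸] [NormedAlgebra ℂ 𝔸] [CompleteSpace 𝔸] (G : Subgroup 𝔸ˣ)

/-! ## §1 The operator layer's interface at one member -/

/-- **THE OPERATOR LAYER AT ONE MEMBER** — the operator-valued fields of `DagBinding.PrintedCarriers9X` over the member's geometry and backgrounds (names and
docstrings as there).  A PARAMETER RECORD: nothing is defined or asserted here; the layer that constructs these from Bałaban's `Δ′_a(U)`, `Δ_U`, … is unassigned.
[cite: Balaban1985BackgroundPropagators, Thms 3.1–3.15 pp.397–432 (the operators the statements are about)] -/
structure OperatorLayerY (x : MemberY d ℓ hd hL b₀ b₁ Mstar) where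
  Gp : B9.KernelFamily (geo9Y x) (bg9Y 𝔸 G x)
  GA : B9.KernelFamily (geo9Y x) (bg9Y 𝔸 G x)
  Cinv : B9.SiteKernel (geo9Y x) (bg9Y 𝔸 G x)
  IsAnalyticExt : B9.KernelFamily (geo9Y x) (bg9Y 𝔸 G x) → (bg9Y 𝔸 G x).Cfg → ℝ → Prop
  E37 : B9.RWExpansion (geo9Y x) (bg9Y 𝔸 G x)
  EK39 : B9.RWKernelExpansion (geo9Y x) (bg9Y 𝔸 G x)
  E310 : B9.RWExpansion (geo9Y x) (bg9Y 𝔸 G x)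
  PosDef : Fin 5 → (bg9Y 𝔸 G x).Cfg → Prop
  GD : B9.KernelFamily (geo9Y x) (bg9Y 𝔸 G x)
  G₁ : B9.KernelFamily (geo9Y x) (bg9Y 𝔸 G x)
  H : B9.HKernel (geo9Y x) (bg9Y 𝔸 G x)
  H₁ : B9.HKernel (geo9Y x) (bg9Y 𝔸 G x)
  HasRWExp : B9.KernelFamily (geo9Y x) (bg9Y 𝔸 G x) → (bg9Y 𝔸 G x).Cfg → ℝ → Prop
  HasRWExpH : B9.HKernel (geo9Y x) (bg9Y 𝔸 G x) → (bg9Y 𝔸 G x).Cfg → ℝ → Prop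
  PosDefK : B9.KernelFamily (geo9Y x) (bg9Y 𝔸 G x) → (bg9Y 𝔸 G x).Cfg → Prop
  GG : B9.KernelFamily (geo9Y x) (bg9Y 𝔸 G x)
  Kdiff : B9.KernelFamily (geo9Y x) (bg9Y 𝔸 G x)
  Ck : B9.SiteKernel (geo9Y x) (bg9Y 𝔸 G x)
  GivenBy3185 : (bg9Y 𝔸 G x).Cfg → Prop
  HasRWExpC : (bg9Y 𝔸 G x).Cfg → ℝ → Prop
  P349 : B9.FineKernel (geo9Y x) (bg9Y 𝔸 G x)
  QGQinv : B9.SiteKernel (geo9Y x) (bg9Y 𝔸 G x)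
  QG1Qinv : B9.SiteKernel (geo9Y x) (bg9Y 𝔸 G x)

/-! ## §2 The carrier bundle as a function of the operator layer -/

/-- **THE [B9] CARRIER BUNDLE OF STAGE 3′(Y) AS A FUNCTION OF THE OPERATOR LAYER**: index `MemberY`, the constants `d + 1` and `c35Y`, geometry `geo9Y`, backgrounds
`bg9Y 𝔸 G`, Cor. 3.6's `InCubeY`, (3.154)'s `dOmegaY`, `OmKY`, `inΛY`, `unitDistY` (MODULES 2–4), and the operator fields of `ops`.
[cite: Balaban1985BackgroundPropagators, Thms 3.1–3.15 pp.397–432 (the carriers of the typed statements)] -/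
def carriersY (ops : ∀ x : MemberY d ℓ hd hL b₀ b₁ Mstar, OperatorLayerY d ℓ hd hL b₀ b₁ Mstar 𝔸 G x) : PrintedCarriers9X where
  I9 := MemberY d ℓ hd hL b₀ b₁ Mstar
  d9 := d + 1
  c35 := c35Y
  geo9 := geo9Y
  bg9 := bg9Y 𝔸 G
  InCube := InCubeY
  Gp := fun x => (ops x).Gp
  GA := fun x => (ops x).GA
  Cinv := fun x => (ops x).Cinv
  IsAnalyticExt := fun x => (ops x).IsAnalyticExt
  E37 := fun x => (ops x).E37
  EK39 := fun x => (ops x).EK39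
  E310 := fun x => (ops x).E310
  PosDef := fun x => (ops x).PosDef
  GD := fun x => (ops x).GD
  G₁ := fun x => (ops x).G₁
  H := fun x => (ops x).H
  H₁ := fun x => (ops x).H₁
  HasRWExp := fun x => (ops x).HasRWExp
  HasRWExpH := fun x => (ops x).HasRWExpH
  PosDefK := fun x => (ops x).PosDefK
  GG := fun x => (ops x).GG
  Kdiff := fun x => (ops x).Kdiff
  dOmega := dOmegaY
  Ck := fun x => (ops x).Ck
  inΛ := inΛY
  unitDist := unitDistY
  GivenBy3185 := fun x => (ops x).GivenBy3185
  HasRWExpC := fun x => (ops x).HasRWExpC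
  P349 := fun x => (ops x).P349
  QGQinv := fun x => (ops x).QGQinv
  QG1Qinv := fun x => (ops x).QG1Qinv
  OmK := OmKY

variable {d ℓ hd hL b₀ b₁ Mstar 𝔸 G}
variable (ops : ∀ x : MemberY d ℓ hd hL b₀ b₁ Mstar, OperatorLayerY d ℓ hd hL b₀ b₁ Mstar 𝔸 G x)

/-- the index of the bundle is the member type. [cite: Balaban1985BackgroundPropagators, p.399 (bookkeeping)] -/
theorem carriersY_I9 : (carriersY d ℓ hd hL b₀ b₁ Mstar 𝔸 G ops).I9 = MemberY d ℓ hd hL b₀ b₁ Mstar := rfl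
/-- the geometry of the bundle is `geo9Y`. [cite: Balaban1985BackgroundPropagators, Sect. A pp.396–397 (bookkeeping)] -/
theorem carriersY_geo9 : (carriersY d ℓ hd hL b₀ b₁ Mstar 𝔸 G ops).geo9 = geo9Y := rfl
/-- the backgrounds of the bundle are `bg9Y`. [cite: Balaban1985BackgroundPropagators, (3.35)–(3.38) p.396 (bookkeeping)] -/
theorem carriersY_bg9 : (carriersY d ℓ hd hL b₀ b₁ Mstar 𝔸 G ops).bg9 = bg9Y 𝔸 G := rfl
/-- the O(1) of (3.35) at the bundle is `10`. [cite: Balaban1985BackgroundPropagators, p.396 (bookkeeping)] -/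
theorem carriersY_c35 : (carriersY d ℓ hd hL b₀ b₁ Mstar 𝔸 G ops).c35 = 10 := rfl
/-- (3.154) at the bundle is `dOmegaY`. [cite: Balaban1985BackgroundPropagators, (3.154) p.427 (bookkeeping)] -/
theorem carriersY_dOmega : (carriersY d ℓ hd hL b₀ b₁ Mstar 𝔸 G ops).dOmega = dOmegaY := rfl

/-! ## §3 The N06 knit at the bundle: geometric hypotheses discharged -/

section Knit

variable [NormOneClass 𝔸]

/-- **`B6BlockParam (towerBlockOfRecord …) → B9LeafX (carriersY … ops)` — the N06 knit AT THE STAGE-3′(Y) BUNDLE with every geometric input discharged**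
(`hd := rfl`, `hc := c35Y_pos`, `hone := reg335Y_one`, `S :=` dag-n03-b's `modelSignsOn_geo9K`, `Dict := dictAtOneY`).  Displayed: the `U = 1` operator comparisons
against NODE 00's readings `GpU ∕ CinvU ∕ GU` (eight per member), the null readings of `GA`'s (3.44)∕(3.45) quantities on the SITE summand, the residual entries, the
Sect. B step, the gauge reduction, the sixteen whole-statement leaves — the operator layer's obligations, nothing else.
[cite: Balaban1985BackgroundPropagators, Thms 3.1–3.15 pp.397–432; Cor. 3.5 proof p.407] -/
theorem b9LeafX_carriersY (δ₀ : ℝ) {Jt Kt : Type} (tree : Jt → B6.TreeData) (loc : Kt → B6.LocalOp)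
    (hGp_e : ∀ (x : MemberY d ℓ hd hL b₀ b₁ Mstar) (n : Fin 4) (lam : (geo9Y x).Loc) (y : (geo9Y x).Site),
      (ops x).Gp.e n (bg9Y 𝔸 G x).one lam y ≤ (Node00.GpU x.toKIdx).e n lam y)
    (hGp_h1 : ∀ (x : MemberY d ℓ hd hL b₀ b₁ Mstar) (lam : (geo9Y x).Loc) (b : ℝ) (ζ : (geo9Y x).Cut),
      (ops x).Gp.h1 (bg9Y 𝔸 G x).one lam b ζ ≤ (Node00.GpU x.toKIdx).h1 lam b ζ)
    (hC : ∀ (x : MemberY d ℓ hd hL b₀ b₁ Mstar) (y y' : (geo9Y x).Site), |(ops x).Cinv.ker (bg9Y 𝔸 G x).one y y'| ≤ |(Node00.CinvU x.toKIdx).ker y y'|)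
    (hGA_e : ∀ (x : MemberY d ℓ hd hL b₀ b₁ Mstar) (n : Fin 4) (lam : (geo9Y x).Loc) (y : (geo9Y x).Site),
      (ops x).GA.e n (bg9Y 𝔸 G x).one lam y ≤ (Node00.GU x.toKIdx).e n lam y)
    (hGA_h1 : ∀ (x : MemberY d ℓ hd hL b₀ b₁ Mstar) (lam : (geo9Y x).Loc) (b : ℝ) (ζ : (geo9Y x).Cut),
      (ops x).GA.h1 (bg9Y 𝔸 G x).one lam b ζ ≤ (Node00.GU x.toKIdx).h1 lam b ζ)
    (hGA_e4 : ∀ (x : MemberY d ℓ hd hL b₀ b₁ Mstar) (lam : (geo9Y x).Loc) (y : (geo9Y x).Site),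
      (ops x).GA.e4 (bg9Y 𝔸 G x).one lam y ≤ (Node00.GU x.toKIdx).e4 lam y)
    (hGA_h2 : ∀ (x : MemberY d ℓ hd hL b₀ b₁ Mstar) (lam : (geo9Y x).Loc) (b : ℝ) (ζ : (geo9Y x).Cut),
      (ops x).GA.h2 (bg9Y 𝔸 G x).one lam b ζ ≤ (Node00.GU x.toKIdx).h2 lam b ζ)
    (hGA_l2 : ∀ (x : MemberY d ℓ hd hL b₀ b₁ Mstar) (n : Fin 6) (lam : (geo9Y x).Loc) (h : (geo9Y x).Cut),
      (ops x).GA.l2 n (bg9Y 𝔸 G x).one lam h ≤ (Node00.GU x.toKIdx).l2 n lam h)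
    (hE4 : ∀ (x : MemberY d ℓ hd hL b₀ b₁ Mstar) (lam : (geo9Y x).Loc), ¬ (lam.isRight = true) → ∀ y, (ops x).GA.e4 (bg9Y 𝔸 G x).one lam y ≤ 0)
    (hH2 : ∀ (x : MemberY d ℓ hd hL b₀ b₁ Mstar) (lam : (geo9Y x).Loc), ¬ (lam.isRight = true) →
      ∀ (β : ℝ) (ζ : (geo9Y x).Cut), (ops x).GA.h2 (bg9Y 𝔸 G x).one lam β ζ ≤ 0)
    (hGp : B9FromB6.ResidualGpAtOne geo9Y (bg9Y 𝔸 G) (fun x => (ops x).Gp))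
    (hGA : B9FromB6.ResidualGAGlobAtOne geo9Y (bg9Y 𝔸 G) (fun x => (ops x).GA))
    (hB : B9.SectBStepPrinted (d + 1) c35Y geo9Y (bg9Y 𝔸 G) (fun x => (ops x).Gp) (fun x => (ops x).GA) (fun x => (ops x).Cinv)
      (fun x => (ops x).IsAnalyticExt))
    (hg : B9.GaugeReduction335 (d + 1) c35Y geo9Y (bg9Y 𝔸 G) InCubeY (fun x => (ops x).Gp) (fun x => (ops x).GA) (fun x => (ops x).Cinv))
    (t37 : B9.Thm37Printed c35Y geo9Y (bg9Y 𝔸 G) (fun x => (ops x).E37))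
    (c38 : B9.Cor38Printed c35Y geo9Y (bg9Y 𝔸 G) (fun x => (ops x).E37))
    (t39 : B9.Thm39Printed (d + 1) c35Y geo9Y (bg9Y 𝔸 G) (fun x => (ops x).EK39))
    (t310 : B9.Thm310Printed c35Y geo9Y (bg9Y 𝔸 G) (fun x => (ops x).E310))
    (hsum : B9.RWSumsYieldIneqs geo9Y (bg9Y 𝔸 G) (fun x => (ops x).E37) (fun x => (ops x).E310) (fun x => (ops x).Gp) (fun x => (ops x).GA))
    (hksum : B9.RWKernelSumYields (d + 1) geo9Y (bg9Y 𝔸 G) (fun x => (ops x).EK39) (fun x => (ops x).Cinv))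
    (t311 : B9.Thm311Printed c35Y geo9Y (bg9Y 𝔸 G) (fun x => (ops x).PosDef))
    (t312 : B9.Thm312Printed (d + 1) c35Y geo9Y (bg9Y 𝔸 G) (fun x => (ops x).GD) (fun x => (ops x).G₁) (fun x => (ops x).H)
      (fun x => (ops x).H₁) (fun x => (ops x).HasRWExp) (fun x => (ops x).HasRWExpH) (fun x => (ops x).PosDefK))
    (t313 : B9.Thm313Printed c35Y geo9Y (bg9Y 𝔸 G) (fun x => (ops x).GG) (fun x => (ops x).HasRWExp) (fun x => (ops x).PosDefK))
    (t314 : B9.Thm314Printed c35Y geo9Y (bg9Y 𝔸 G) (fun x => (ops x).Kdiff) dOmegaY)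
    (t315 : B9.Thm315FullPrinted c35Y geo9Y (bg9Y 𝔸 G) (fun x => (ops x).Ck) inΛY unitDistY (fun x => (ops x).GivenBy3185)
      (fun x => (ops x).HasRWExpC))
    (s349 : B9.Stmt349Printed (d + 1) c35Y geo9Y (bg9Y 𝔸 G) (fun x => (ops x).P349))
    (s3132 : B9.Stmt3132Printed (d + 1) c35Y geo9Y (bg9Y 𝔸 G) (fun x => (ops x).QGQinv) (fun x => (ops x).QG1Qinv))
    (t314loc : B9Thm314.Thm314LocalPrinted c35Y geo9Y (bg9Y 𝔸 G) (fun x => (ops x).Kdiff) OmKY dOmegaY)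
    (h6 : B6BlockParam (Node00.towerBlockOfRecord d ℓ hd hL b₀ b₁ δ₀ tree loc)) :
    B9LeafX (carriersY d ℓ hd hL b₀ b₁ Mstar 𝔸 G ops) :=
  B9LeafKnitOn.b9LeafX_of_b6BlockParam_on (carriersY d ℓ hd hL b₀ b₁ Mstar 𝔸 G ops) (Node00.towerBlockOfRecord d ℓ hd hL b₀ b₁ δ₀ tree loc) rfl
    (fun x => ⟨x.toKIdx, x.hcfk⟩)
    (fun x => dictAtOneY x (ops x).Gp (ops x).GA (ops x).Cinv (hGp_e x) (hGp_h1 x) (hC x) (hGA_e x) (hGA_h1 x) (hGA_e4 x) (hGA_h2 x) (hGA_l2 x))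
    (fun _ => fun lam => lam.isRight = true) (fun x => B9GeoNormsKLevelModelSignsV1.modelSignsOn_geo9K x.toKIdx) hE4 hH2 hGp hGA c35Y_pos
    (fun x _ hα => B9PinMembersKLevelV1.reg335Y_one x c35Y_pos hα) hB hg t37 c38 t39 t310 hsum hksum t311 t312 t313 t314 t315 s349 s3132
    t314loc h6

end Knit

/-! ## §4 Guards at the bundle -/

/-- the bundle's index is inhabited (odd `L ≥ 5`, band `0 < b₀ ≤ b₁`). [cite: Balaban1985BackgroundPropagators, p.399 (the family is inhabited)] -/
theorem carriersY_nonempty_I9 (hℓ : 4 ≤ ℓ) (hb₀ : 0 < b₀) (hb₁ : b₀ ≤ b₁) : Nonempty (carriersY d ℓ hd hL b₀ b₁ Mstar 𝔸 G ops).I9 :=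
  B9PinMembersKLevelV1.memberY_nonempty hℓ hb₀ hb₁

/-- `M` is unbounded over the bundle's index: every «∃ M₁ ∀ i, M₁ ≤ M_i → …» of the leaf binds.
[cite: Balaban1985BackgroundPropagators, Thm 3.1 p.397 («for M ≥ M₁»)] -/
theorem carriersY_unbounded_M (hℓ : 4 ≤ ℓ) (hb₀ : 0 < b₀) (hb₁ : b₀ ≤ b₁) (M₂ : ℝ) :
    ∃ i : (carriersY d ℓ hd hL b₀ b₁ Mstar 𝔸 G ops).I9, M₂ ≤ ((carriersY d ℓ hd hL b₀ b₁ Mstar 𝔸 G ops).geo9 i).M :=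
  B9PinMembersKLevelV1.memberY_unbounded_M hℓ hb₀ hb₁ M₂

/-- at `L = 5` the bundle has members with non-empty `Λ` (Thm 3.15 not vacuous over the index there).
[cite: Balaban1985BackgroundPropagators, Thm 3.15 p.432 (non-vacuity of the typed datum)] -/
theorem carriersY_exists_nonempty_Λ (hℓ : 4 ≤ ℓ) (hℓ4 : ℓ ≤ 4) {k : ℕ} (hk : 2 ≤ k) (hb₀ : 0 < b₀) (hb₁ : b₀ ≤ b₁) (M₂ : ℝ) :
    ∃ i : (carriersY d ℓ hd hL b₀ b₁ Mstar 𝔸 G ops).I9, i.k = k ∧ M₂ ≤ ((carriersY d ℓ hd hL b₀ b₁ Mstar 𝔸 G ops).geo9 i).M ∧ i.Λ.Nonempty :=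
  B9PinMembersKLevelV1.memberY_exists_nonempty_Λ hℓ hℓ4 hk hb₀ hb₁ M₂

/-- Cor. 3.6 at the bundle is VACUOUS (MODULE 4's located fact `not_inCubeY`), for any operator layer.
[cite: Balaban1985BackgroundPropagators, Cor. 3.6 p.408 (bookkeeping: vacuity at these carriers)] -/
theorem carriersY_cor36_vacuous :
    B9.Cor36Printed (d + 1) c35Y geo9Y (bg9Y 𝔸 G) InCubeY (fun x => (ops x).Gp) (fun x => (ops x).GA) (fun x => (ops x).Cinv) :=
  B9PinGeometryKLevelV1.cor36Printed_vacuous (d + 1) c35Y (bg9Y 𝔸 G) _ _ _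

end Literature.MathematicalPhysics.QuantumFieldTheory.Balaban1983to89.B9PinCarriersKLevelV1

end
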